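import Literature.Probability.LatticeModels.GridDomainBeurling
import Mathlib.Analysis.Normed.Module.FiniteDimension
import HarnessLib

/-!
# Boundary hitting in grid domains (LSW 2004, Lemma 5.3) — proved steps, VI:
# exit paths of bounded length ("two grid paths of bounded length")

Topic `Literature/Probability/LatticeModels`; sixth sibling of `GridDomainHittingProbability.lean`
(the named fact `boundaryHitting`, G. F. Lawler, O. Schramm, W. Werner, *Conformal invariance of
planar loop-erased random walks and uniform spanning trees*, Ann. Probab. 32 (2004), Lemma 5.3).
The printed proof treats vertices at bounded distance `r ≤ r₀` from `∂D` separately: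

> "Suppose `r ≤ r₀`. Then there are two grid paths of bounded length starting from `w` to `∂D`
> […] with probability bounded away from `0` the random walk from `w` hits `∂D` before `α`, since
> it may follow any one of these two paths."

This file proves the corresponding statement for the killed walk of the tree, with the conformal
displacement along the path controlled by the Koebe step of `GridDomainConformalSteps.lean`
(one path suffices, because in the tree the conformal radius of the round is proportional to
`1 - |ψ(w)|`, so no harmonic-measure argument is needed at bounded scales):

* `LSWGrid.exists_latticePath` — a monotone lattice path from `x` to `q` of length
  `|q₀ - x₀| + |q₁ - x₁|`; `LSWGrid.latticePath_mem_sqBox` — after `i` steps a lattice path is in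
  the box `sqBox x i`;
* `LSWGrid.pow_le_tsum_exitAfterAvoiding_of_path` — **the walk follows a given path**: if
  `v₀, …, v_k ∈ V ∖ A` is a lattice path and `v_{k+1} ∉ V` is a lattice neighbour of `v_k`, the walk
  on `siteGraph V` from `v₀` is killed before hitting `A` with probability `≥ 4^{-(k+1)}`
  (first-step equation `SRW.tsum_exitAfterAvoiding_first_step`, induction);
* `LSWGrid.conformal_bounds_of_path` — along a lattice path in `V(D)`,
  `1 - |ψ v_i| ≤ 15^i (1 - |ψ v₀|)` and `|ψ v_i - ψ v₀| ≤ (15^i - 1)(1 - |ψ v₀|)`;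
* `LSWGrid.exists_not_mem_latticeVertices_mem_sqBox` — if `dist(x, Dᶜ) < s` for a vertex `x` of a
  grid domain then some lattice point outside `V(D)` lies in `sqBox x (⌊s⌋₊ + 1)` (the nearest
  boundary point lies on a boundary edge, whose endpoints are off `D`);
* `LSWGrid.hitBeforeExitProb_le_of_near_boundary` — **Case A of the one-round lemma**: if a
  lattice point outside `V(D)` lies in `sqBox y m`, `y ∈ V(D)`, then for every target `B` avoiding
  the sites `u ∈ V(D) ∩ sqBox y (2m)` with `|ψ u - ψ y| ≤ (15^{2m} - 1)(1 - |ψ y|)`,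
  `hitBeforeExitProb D y B ≤ 1 - 4^{-(2m+1)}`.

Everything here is proved; no definition and no named fact is introduced.

## References

* G. F. Lawler, O. Schramm, W. Werner, Ann. Probab. 32 (2004) 939–995, §5.1 [LawlerSchrammWerner2004].
-/

noncomputable section

open Set Metric Filter
open scoped Classical Topology
open Literature.Probability.RandomPlanarGeometry (ChordalLERW.siteGraph ChordalLERW.siteGraph_adj_iff)

namespace Literature.Probability.LatticeModels

open WeakBeurling (sqBox mem_sqBox sqBox_mono sqBox_finite mem_sqBox_succ_of_adj)

namespace LSWGrid

/-! ### Monotone lattice paths -/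

/-- One coordinate step towards `q`. [folklore] -/
theorem exists_step_towards {x q : Site 2} (h : x ≠ q) :
    ∃ e : SRW.Dir 2, |q 0 - (x + SRW.stepVec e) 0| + |q 1 - (x + SRW.stepVec e) 1| + 1 =
      |q 0 - x 0| + |q 1 - x 1| := by
  have hne : q 0 ≠ x 0 ∨ q 1 ≠ x 1 := by
    by_contra hc
    push Not at hc
    exact h (funext fun i => by fin_cases i <;> simp [hc.1.symm, hc.2.symm])
  rcases hne with h0 | h1
  · by_cases hlt : x 0 < q 0
    · refine ⟨((0 : Fin 2), true), ?_⟩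
      simp only [Pi.add_apply, SRW.stepVec_apply]
      simp only [Fin.isValue, ↓reduceIte, one_ne_zero, add_zero]
      rw [abs_of_nonneg (by omega : (0 : ℤ) ≤ q 0 - (x 0 + 1)), abs_of_pos (by omega : (0 : ℤ) < q 0 - x 0)]
      ring
    · refine ⟨((0 : Fin 2), false), ?_⟩
      simp only [Pi.add_apply, SRW.stepVec_apply]
      simp only [Fin.isValue, ↓reduceIte, Bool.false_eq_true, one_ne_zero, add_zero]
      rw [abs_of_nonpos (by omega : q 0 - (x 0 + -1) ≤ 0), abs_of_neg (by omega : q 0 - x 0 < 0)]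
      ring
  · by_cases hlt : x 1 < q 1
    · refine ⟨((1 : Fin 2), true), ?_⟩
      simp only [Pi.add_apply, SRW.stepVec_apply]
      simp only [Fin.isValue, zero_ne_one, ↓reduceIte, add_zero]
      rw [abs_of_nonneg (by omega : (0 : ℤ) ≤ q 1 - (x 1 + 1)), abs_of_pos (by omega : (0 : ℤ) < q 1 - x 1)]
      ring
    · refine ⟨((1 : Fin 2), false), ?_⟩
      simp only [Pi.add_apply, SRW.stepVec_apply]
      simp only [Fin.isValue, zero_ne_one, ↓reduceIte, Bool.false_eq_true, add_zero]
      rw [abs_of_nonpos (by omega : q 1 - (x 1 + -1) ≤ 0), abs_of_neg (by omega : q 1 - x 1 < 0)]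
      ring

/-- **Monotone lattice paths**: from `x` to `q` there is a lattice path of length
`|q₀ - x₀| + |q₁ - x₁|`. [folklore] -/
theorem exists_latticePath (x q : Site 2) : ∃ (n : ℕ) (v : ℕ → Site 2), v 0 = x ∧ v n = q ∧
    (∀ i < n, (zdGraph 2).Adj (v i) (v (i + 1))) ∧ (n : ℤ) = |q 0 - x 0| + |q 1 - x 1| := by
  have key : ∀ (m : ℕ) (x : Site 2), |q 0 - x 0| + |q 1 - x 1| = m → ∃ v : ℕ → Site 2,
      v 0 = x ∧ v m = q ∧ ∀ i < m, (zdGraph 2).Adj (v i) (v (i + 1)) := by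
    intro m
    induction m with
    | zero =>
      intro x hx
      have h0 : q 0 = x 0 := by
        have := abs_nonneg (q 0 - x 0); have := abs_nonneg (q 1 - x 1)
        have : |q 0 - x 0| = 0 := by push_cast at hx; linarith
        linarith [abs_eq_zero.1 this]
      have h1 : q 1 = x 1 := by
        have := abs_nonneg (q 0 - x 0); have := abs_nonneg (q 1 - x 1)
        have : |q 1 - x 1| = 0 := by push_cast at hx; linarith
        linarith [abs_eq_zero.1 this]
      refine ⟨fun _ => x, rfl, ?_, fun i hi => absurd hi (Nat.not_lt_zero i)⟩
      exact funext fun i => by fin_cases i <;> simp [h0, h1]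
    | succ m ih =>
      intro x hx
      have hxq : x ≠ q := by
        rintro rfl
        simp at hx
        omega
      obtain ⟨e, he⟩ := exists_step_towards hxq
      have hx' : |q 0 - (x + SRW.stepVec e) 0| + |q 1 - (x + SRW.stepVec e) 1| = m := by
        push_cast at hx; linarith
      obtain ⟨v', hv'0, hv'm, hv'adj⟩ := ih (x + SRW.stepVec e) hx'
      refine ⟨fun i => if i = 0 then x else v' (i - 1), by simp, ?_, ?_⟩
      · simp [hv'm]
      · intro i hi
        rcases Nat.eq_zero_or_pos i with rfl | hpos
        · simp only [if_true, zero_add, one_ne_zero, if_false, Nat.sub_self, hv'0]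
          exact SRW.adj_add_stepVec x e
        · have h1 : i ≠ 0 := by omega
          have h2 : i + 1 ≠ 0 := by omega
          simp only [h1, h2, if_false]
          have := hv'adj (i - 1) (by omega)
          rwa [show i - 1 + 1 = i + 1 - 1 by omega] at this
  have hnn : 0 ≤ |q 0 - x 0| + |q 1 - x 1| := by positivity
  obtain ⟨v, hv0, hvn, hvadj⟩ := key (|q 0 - x 0| + |q 1 - x 1|).toNat x (Int.toNat_of_nonneg hnn).symm
  exact ⟨_, v, hv0, hvn, hvadj, Int.toNat_of_nonneg hnn⟩

/-- A lattice path stays in the box of radius (number of steps) about its start. [folklore] -/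
theorem latticePath_mem_sqBox {v : ℕ → Site 2} {n : ℕ} (hadj : ∀ i < n, (zdGraph 2).Adj (v i) (v (i + 1))) :
    ∀ i ≤ n, v i ∈ sqBox (v 0) i := by
  intro i
  induction i with
  | zero => intro; simp [mem_sqBox]
  | succ i ih =>
    intro hi
    have h := mem_sqBox_succ_of_adj (ih (by omega)) (hadj i (by omega))
    exact_mod_cast h

/-! ### The walk follows a given path -/

/-- **The walk follows a given path.** If `v₀, …, v_k ∈ V ∖ A` is a lattice path and the
lattice neighbour `v_{k+1}` of `v_k` is not in `V`, the walk on `siteGraph V` started at `v₀` is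
killed before hitting `A` with probability at least `4^{-(k+1)}` (it may follow the path and
attempt the non-edge `v_k v_{k+1}`). [folklore] -/
theorem pow_le_tsum_exitAfterAvoiding_of_path {V A : Set (Site 2)} :
    ∀ (k : ℕ) (v : ℕ → Site 2), (∀ i ≤ k, v i ∈ V) → (∀ i ≤ k, v i ∉ A) →
      (∀ i ≤ k, (zdGraph 2).Adj (v i) (v (i + 1))) → v (k + 1) ∉ V →
      (4⁻¹ : ℝ) ^ (k + 1) ≤ ∑' q, SRW.exitAfterAvoiding (ChordalLERW.siteGraph V) (v 0) q A := by
  intro k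
  induction k with
  | zero =>
    intro v hV hA hadj hout
    have h0A := hA 0 le_rfl
    rw [SRW.tsum_exitAfterAvoiding_first_step, if_neg h0A]
    obtain ⟨e, he⟩ := SRW.exists_dir_of_adj (hadj 0 le_rfl)
    have hkill : e ∈ SRW.killingDirs (ChordalLERW.siteGraph V) (v 0) := by
      rw [SRW.killingDirs, Finset.mem_filter, siteGraph_adj_add_stepVec_iff]
      exact ⟨Finset.mem_univ _, fun h => hout (by rw [he]; exact h.2)⟩
    have hcard : (1 : ℝ) ≤ (SRW.killingDirs (ChordalLERW.siteGraph V) (v 0)).card := by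
      have := Finset.card_pos.2 ⟨e, hkill⟩
      exact_mod_cast this
    have hsum : 0 ≤ ∑ e : SRW.Dir 2, (if (ChordalLERW.siteGraph V).Adj (v 0) (v 0 + SRW.stepVec e) then
        ∑' q, SRW.exitAfterAvoiding (ChordalLERW.siteGraph V) (v 0 + SRW.stepVec e) q A else 0) :=
      Finset.sum_nonneg fun e _ => by
        split_ifs
        · exact SRW.tsum_exitAfterAvoiding_nonneg _ _ _
        · exact le_rfl
    have h4 : (2 * ((2 : ℕ) : ℝ))⁻¹ = 4⁻¹ := by norm_num
    simp only [h4, zero_add, pow_one]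
    linarith [mul_nonneg (by norm_num : (0 : ℝ) ≤ 4⁻¹) hsum]
  | succ k ih =>
    intro v hV hA hadj hout
    have h0A := hA 0 (Nat.zero_le _)
    have h0V := hV 0 (Nat.zero_le _)
    have h1V := hV 1 (by omega)
    rw [SRW.tsum_exitAfterAvoiding_first_step, if_neg h0A]
    obtain ⟨e, he⟩ := SRW.exists_dir_of_adj (hadj 0 (Nat.zero_le _))
    rw [zero_add] at he
    have hadj' : (ChordalLERW.siteGraph V).Adj (v 0) (v 0 + SRW.stepVec e) := by
      rw [siteGraph_adj_add_stepVec_iff, ← he]; exact ⟨h0V, h1V⟩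
    -- the induction hypothesis for the shifted path
    have hih := ih (fun i => v (i + 1)) (fun i hi => hV (i + 1) (by omega)) (fun i hi => hA (i + 1) (by omega))
      (fun i hi => hadj (i + 1) (by omega)) hout
    rw [he] at hih
    have hsingle : (if (ChordalLERW.siteGraph V).Adj (v 0) (v 0 + SRW.stepVec e) then
        ∑' q, SRW.exitAfterAvoiding (ChordalLERW.siteGraph V) (v 0 + SRW.stepVec e) q A else 0) ≤
        ∑ e : SRW.Dir 2, (if (ChordalLERW.siteGraph V).Adj (v 0) (v 0 + SRW.stepVec e) then
          ∑' q, SRW.exitAfterAvoiding (ChordalLERW.siteGraph V) (v 0 + SRW.stepVec e) q A else 0) :=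
      Finset.single_le_sum (f := fun e => if (ChordalLERW.siteGraph V).Adj (v 0) (v 0 + SRW.stepVec e) then
          ∑' q, SRW.exitAfterAvoiding (ChordalLERW.siteGraph V) (v 0 + SRW.stepVec e) q A else 0)
        (fun e _ => by
          split_ifs
          · exact SRW.tsum_exitAfterAvoiding_nonneg _ _ _
          · exact le_rfl) (Finset.mem_univ e)
    rw [if_pos hadj'] at hsingle
    have hcard : (0 : ℝ) ≤ (SRW.killingDirs (ChordalLERW.siteGraph V) (v 0)).card := Nat.cast_nonneg _
    have h4 : (2 * ((2 : ℕ) : ℝ))⁻¹ = 4⁻¹ := by norm_num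
    simp only [h4]
    calc (4⁻¹ : ℝ) ^ (k + 1 + 1) = 4⁻¹ * (4⁻¹) ^ (k + 1) := by ring
      _ ≤ 4⁻¹ * ∑' q, SRW.exitAfterAvoiding (ChordalLERW.siteGraph V) (v 0 + SRW.stepVec e) q A := by
          gcongr
      _ ≤ _ := by nlinarith

/-! ### Conformal displacement along a path in `V(D)` -/

variable {D : Set ℂ}

/-- **Conformal bounds along a lattice path in `V(D)`**: `1 - |ψ v_i| ≤ 15^i (1 - |ψ v₀|)` and
`|ψ v_i - ψ v₀| ≤ (15^i - 1)(1 - |ψ v₀|)` (iterate the Koebe step `norm_sub_le_of_adj`). [folklore] -/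
theorem conformal_bounds_of_path (hD : IsGridDomain D) {ψ : ℂ → ℂ} (hψ : DifferentiableOn ℂ ψ D)
    (hmaps : MapsTo ψ D (ball 0 1)) {v : ℕ → Site 2} {k : ℕ}
    (hV : ∀ i ≤ k, v i ∈ latticeVertices D) (hadj : ∀ i < k, (zdGraph 2).Adj (v i) (v (i + 1))) :
    ∀ i ≤ k, 1 - ‖ψ (Site.toComplex (v i))‖ ≤ 15 ^ i * (1 - ‖ψ (Site.toComplex (v 0))‖) ∧
      ‖ψ (Site.toComplex (v i)) - ψ (Site.toComplex (v 0))‖ ≤ (15 ^ i - 1) * (1 - ‖ψ (Site.toComplex (v 0))‖) := by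
  intro i
  induction i with
  | zero => intro; simp
  | succ i ih =>
    intro hi
    obtain ⟨ih1, ih2⟩ := ih (by omega)
    have h1 := hD.one_sub_norm_le_of_adj hψ hmaps (hV i (by omega)) (hV (i + 1) hi) (hadj i (by omega))
    have h2 := hD.norm_sub_le_of_adj hψ hmaps (hV i (by omega)) (hV (i + 1) hi) (hadj i (by omega))
    have hη : 0 ≤ 1 - ‖ψ (Site.toComplex (v 0))‖ := by
      have := hmaps (hV 0 (Nat.zero_le _)); rw [mem_ball_zero_iff] at this; linarith
    refine ⟨?_, ?_⟩
    · calc 1 - ‖ψ (Site.toComplex (v (i + 1)))‖ ≤ 15 * (1 - ‖ψ (Site.toComplex (v i))‖) := h1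
        _ ≤ 15 * (15 ^ i * (1 - ‖ψ (Site.toComplex (v 0))‖)) := by gcongr
        _ = 15 ^ (i + 1) * (1 - ‖ψ (Site.toComplex (v 0))‖) := by ring
    · calc ‖ψ (Site.toComplex (v (i + 1))) - ψ (Site.toComplex (v 0))‖
          ≤ ‖ψ (Site.toComplex (v (i + 1))) - ψ (Site.toComplex (v i))‖ +
            ‖ψ (Site.toComplex (v i)) - ψ (Site.toComplex (v 0))‖ := norm_sub_le_norm_sub_add_norm_sub _ _ _
        _ ≤ 14 * (1 - ‖ψ (Site.toComplex (v i))‖) + (15 ^ i - 1) * (1 - ‖ψ (Site.toComplex (v 0))‖) :=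
            add_le_add h2 ih2
        _ ≤ 14 * (15 ^ i * (1 - ‖ψ (Site.toComplex (v 0))‖)) + (15 ^ i - 1) * (1 - ‖ψ (Site.toComplex (v 0))‖) := by
            gcongr
        _ = (15 ^ (i + 1) - 1) * (1 - ‖ψ (Site.toComplex (v 0))‖) := by ring

/-! ### A lattice point off `V(D)` near a vertex close to the boundary -/

/-- If `dist(x, Dᶜ) < s` for a lattice point `x ∈ V(D)` of a grid domain, some lattice point
outside `V(D)` lies in the box `sqBox x (⌊s⌋₊ + 1)`: the nearest boundary point lies on a
boundary edge, whose endpoints are off `D`. [folklore] -/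
theorem exists_not_mem_latticeVertices_mem_sqBox (hD : IsGridDomain D) (hDne : D ≠ univ) {x : Site 2}
    (hx : x ∈ latticeVertices D) {s : ℝ} (hs : infDist (Site.toComplex x) Dᶜ < s) :
    ∃ q : Site 2, q ∉ latticeVertices D ∧ q ∈ sqBox x (⌊s⌋₊ + 1 : ℕ) := by
  obtain ⟨y, hyfr, hyd⟩ := exists_mem_frontier_infDist_compl_eq_dist (x := Site.toComplex x) (s := D) hx hDne
  have hfrc := hD.frontier_subset_compl
  obtain ⟨hopen, -, E, hE, hfront⟩ := hD
  have hyfr' := hyfr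
  rw [hfront] at hyfr'
  obtain ⟨e, heE, hye⟩ := mem_iUnion₂.1 hyfr'
  -- an endpoint `q` of the boundary edge through `y` within `1/2` of `y`; it is off `D`
  obtain ⟨q, hqfr, hqy⟩ : ∃ q : Site 2, Site.toComplex q ∈ frontier D ∧ ‖y - Site.toComplex q‖ ≤ 1 / 2 := by
    rcases exists_norm_sub_le_half_of_mem_segment (Or.inr (hE e heE)) hye with h | h
    · exact ⟨e.1, by rw [hfront]; exact mem_iUnion₂.2 ⟨e, heE, left_mem_segment _ _ _⟩, h⟩
    · exact ⟨e.2, by rw [hfront]; exact mem_iUnion₂.2 ⟨e, heE, right_mem_segment _ _ _⟩, h⟩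
  have hq : q ∉ latticeVertices D := fun h => hfrc hqfr h
  refine ⟨q, hq, ?_⟩
  -- distances: `|y - x| < s`, `|q - y| ≤ 1/2`
  have hxy : dist (Site.toComplex x) y < s := by rwa [← hyd]
  have hdist : ‖Site.toComplex q - Site.toComplex x‖ < s + 1 := by
    have h1 : ‖Site.toComplex q - Site.toComplex x‖ ≤ ‖Site.toComplex q - y‖ + ‖y - Site.toComplex x‖ :=
      norm_sub_le_norm_sub_add_norm_sub _ _ _
    have h2 : ‖Site.toComplex q - y‖ ≤ 1 / 2 := by rwa [norm_sub_rev]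
    have h3 : ‖y - Site.toComplex x‖ < s := by rwa [← dist_eq_norm, dist_comm]
    linarith
  rw [mem_sqBox]
  have hcoord : ∀ i : Fin 2, |((q i - x i : ℤ) : ℝ)| ≤ ‖Site.toComplex q - Site.toComplex x‖ := by
    intro i
    fin_cases i
    · have := Complex.abs_re_le_norm (Site.toComplex q - Site.toComplex x)
      simpa [Site.toComplex] using this
    · have := Complex.abs_im_le_norm (Site.toComplex q - Site.toComplex x)
      simpa [Site.toComplex] using this
  have hfl : s < (⌊s⌋₊ : ℝ) + 1 := Nat.lt_floor_add_one s
  have hbound : ∀ i : Fin 2, |q i - x i| ≤ ((⌊s⌋₊ + 1 : ℕ) : ℤ) := by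
    intro i
    have h := (hcoord i).trans_lt hdist
    have h' : ((|q i - x i| : ℤ) : ℝ) < ((⌊s⌋₊ + 1 : ℕ) : ℤ) + 1 := by
      rw [Int.cast_abs]; push_cast at h ⊢; linarith
    exact Int.lt_add_one_iff.1 (by exact_mod_cast h')
  exact ⟨hbound 0, hbound 1⟩

/-- A grid domain other than the plane misses some lattice point (the endpoints of its boundary
edges are off `D`). [folklore] -/
theorem exists_not_mem_latticeVertices (hD : IsGridDomain D) (hDne : D.Nonempty) (hDu : D ≠ univ) :
    ∃ p : Site 2, p ∉ latticeVertices D := by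
  obtain ⟨y, hy⟩ := nonempty_frontier_iff.2 ⟨hDne, hDu⟩
  have hfrc := hD.frontier_subset_compl
  obtain ⟨-, -, E, -, hfront⟩ := hD
  have hy' := hy
  rw [hfront] at hy'
  obtain ⟨e, heE, -⟩ := mem_iUnion₂.1 hy'
  refine ⟨e.1, fun h => hfrc ?_ h⟩
  rw [hfront]
  exact mem_iUnion₂.2 ⟨e, heE, left_mem_segment _ _ _⟩

/-! ### Case A of the one-round lemma: vertices near the boundary -/

/-- **Case A of the one-round lemma** ("two grid paths of bounded length"). Let `y ∈ V(D)` and let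
some lattice point outside `V(D)` lie in `sqBox y m`. If the target `B` contains no site
`u ∈ V(D) ∩ sqBox y (2m)` with `|ψ u - ψ y| ≤ (15^{2m} - 1)(1 - |ψ y|)`, then the walk from `y`
is killed before hitting `B` with probability at least `4^{-2m}`:
`hitBeforeExitProb D y B ≤ 1 - 4^{-2m}`. [cite: LawlerSchrammWerner2004, §5.1, proof of Lemma 5.3] -/
theorem hitBeforeExitProb_le_of_near_boundary (hD : IsGridDomain D) {ψ : ℂ → ℂ}
    (hψ : DifferentiableOn ℂ ψ D) (hmaps : MapsTo ψ D (ball 0 1)) {y q : Site 2}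
    (hy : y ∈ latticeVertices D) (hq : q ∉ latticeVertices D) {m : ℕ} (hqm : q ∈ sqBox y m)
    {B : Set (Site 2)}
    (hB : ∀ u ∈ latticeVertices D, u ∈ sqBox y (2 * m : ℕ) →
      ‖ψ (Site.toComplex u) - ψ (Site.toComplex y)‖ ≤ (15 ^ (2 * m) - 1) * (1 - ‖ψ (Site.toComplex y)‖) →
        u ∉ B) :
    hitBeforeExitProb D y B ≤ 1 - 4⁻¹ ^ (2 * m) := by
  set V := latticeVertices D with hV
  obtain ⟨n, v, hv0, hvn, hadj, hn⟩ := exists_latticePath y q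
  have hn2m : n ≤ 2 * m := by
    have h := (mem_sqBox.1 hqm)
    have : (n : ℤ) ≤ 2 * m := by rw [hn]; linarith [h.1, h.2]
    exact_mod_cast this
  -- the first index off `V`
  have hex : ∃ i, i ≤ n ∧ v i ∉ V := ⟨n, le_rfl, by rwa [hvn]⟩
  obtain ⟨hjn, hjV⟩ : Nat.find hex ≤ n ∧ v (Nat.find hex) ∉ V := Nat.find_spec hex
  have hbefore : ∀ i < Nat.find hex, v i ∈ V := fun i hi => by
    by_contra h
    exact Nat.find_min hex hi ⟨(le_of_lt hi).trans hjn, h⟩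
  have hj0 : Nat.find hex ≠ 0 := by
    intro h0
    rw [h0, hv0] at hjV
    exact hjV hy
  obtain ⟨k, hk⟩ : ∃ k, Nat.find hex = k + 1 := Nat.exists_eq_succ_of_ne_zero hj0
  rw [hk] at hjn hjV hbefore
  -- the path `v 0, …, v k` lies in `V ∖ B`, inside `sqBox y (2m)`
  have hVk : ∀ i ≤ k, v i ∈ V := fun i hi => hbefore i (Nat.lt_succ_of_le hi)
  have hadjk : ∀ i ≤ k, (zdGraph 2).Adj (v i) (v (i + 1)) := fun i hi => hadj i (by omega)
  have hbox : ∀ i ≤ k, v i ∈ sqBox y (2 * m : ℕ) := fun i hi => by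
    have h := latticePath_mem_sqBox (n := n) hadj i (by omega)
    rw [hv0] at h
    exact sqBox_mono y (by exact_mod_cast (by omega : i ≤ 2 * m)) h
  have hη : 0 ≤ 1 - ‖ψ (Site.toComplex y)‖ := by
    have := hmaps hy; rw [mem_ball_zero_iff] at this; linarith
  have hconf := conformal_bounds_of_path hD hψ hmaps (k := k) hVk (fun i hi => hadjk i (le_of_lt hi))
  have hAk : ∀ i ≤ k, v i ∉ B := fun i hi => by
    refine hB (v i) (hVk i hi) (hbox i hi) ?_
    have h := (hconf i hi).2
    rw [hv0] at h
    refine h.trans (mul_le_mul_of_nonneg_right ?_ hη)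
    have : (15 : ℝ) ^ i ≤ 15 ^ (2 * m) := pow_le_pow_right₀ (by norm_num) (by omega)
    linarith
  have hmain := pow_le_tsum_exitAfterAvoiding_of_path (V := V) (A := B) k v hVk hAk hadjk hjV
  rw [hv0] at hmain
  rw [hitBeforeExitProb_eq]
  have hpow : (4⁻¹ : ℝ) ^ (2 * m) ≤ 4⁻¹ ^ (k + 1) :=
    pow_le_pow_of_le_one (by norm_num) (by norm_num) (by omega)
  linarith

end LSWGrid

end Literature.Probability.LatticeModels
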